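import Summits.Ventures.DiscreteObjects.PP12.CentralCollineation

/-!
# A Bruck-type bound for fixed structures: fixed points off a fixed, not pointwise fixed, line (general order)
Framing: lottery ticket; floor = certified bounds/negative ranges.

**Lemma (`card_fixed_off_line_le_order`).** Let `σ` be a collineation of a finite projective plane of order `n`,
`l` a fixed line and `X ∈ l` a point NOT fixed by `σ`. Then at most `n` fixed points lie off `l`: the map sending a
fixed point `Q ∉ l` to the line `XQ` is injective (two fixed points on one line through `X` would make that line
fixed, and `X`, lying on two fixed lines, fixed) and misses `l`, while only `n + 1` lines pass through `X`.
This is the first half of Bruck's subplane bound (`n ≥ m²` when the fixed structure is a subplane of order `m` and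
`l` one of its lines: `m²` fixed points off `l`), isolated as a reusable lemma (it is the step used in `NoOrderSeven`
and `OrderFive`; successors analysing the live `|G| = 3` cells of PP(12) — planar collineations fixing a subplane of
order 3, where `n = 12 = m² + m` is Bruck-extremal — can start from it). Cell pub-namedobj, target M.
-/

namespace Summit.Ventures.DiscreteObjects.PP12

open Configuration Finset
open scoped Classical

namespace Collineation

variable {P L : Type*} [Membership P L] [ProjectivePlane P L] [Fintype P] [Fintype L] (σ : Collineation P L)

/-- **Fixed points off a fixed line.** If the fixed line `l` carries a non-fixed point, at most `order` fixed points
lie off `l`. -/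
theorem card_fixed_off_line_le_order {l : L} (hl : σ.onLines l = l) {X : P} (hXl : X ∈ l)
    (hXnot : σ.onPoints X ≠ X) :
    (univ.filter fun Q : P => σ.onPoints Q = Q ∧ Q ∉ l).card ≤ ProjectivePlane.order P L := by
  set S : Finset P := univ.filter fun Q : P => σ.onPoints Q = Q ∧ Q ∉ l with hS
  -- lines through X other than l: exactly `order`
  set LX : Finset L := (univ.filter fun m : L => X ∈ m).erase l with hLX
  have hLXcard : LX.card = ProjectivePlane.order P L := by
    have h : (univ.filter fun m : L => X ∈ m).card = ProjectivePlane.order P L + 1 := by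
      rw [← Fintype.card_subtype, ← Nat.card_eq_fintype_card]
      change Configuration.lineCount L X = _
      exact ProjectivePlane.lineCount_eq L X
    rw [Finset.card_erase_of_mem (by simp [hXl]), h]; rfl
  let g : P → L := fun Q => if h : X = Q then l else HasLines.mkLine h
  have hg : ∀ Q ∈ S, X ∈ g Q ∧ Q ∈ g Q ∧ g Q ≠ l := by
    intro Q hQ
    obtain ⟨hQfix, hQl⟩ := (Finset.mem_filter.mp hQ).2
    have hXQ : X ≠ Q := fun h => hXnot (h ▸ hQfix)
    simp only [g, dif_neg hXQ]
    have hax := HasLines.mkLine_ax (L := L) hXQ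
    exact ⟨hax.1, hax.2, fun h => hQl (h ▸ hax.2)⟩
  have hmaps : ∀ Q ∈ S, g Q ∈ LX := fun Q hQ => by
    obtain ⟨h1, -, h3⟩ := hg Q hQ
    simp [hLX, h1, h3]
  have hinj : Set.InjOn g S := by
    intro Q hQ Q' hQ' heq
    by_contra hQQ'
    obtain ⟨hQfix, -⟩ := (Finset.mem_filter.mp hQ).2
    obtain ⟨hQ'fix, -⟩ := (Finset.mem_filter.mp hQ').2
    obtain ⟨hXm, hQm, hml⟩ := hg Q hQ
    obtain ⟨-, hQ'm, -⟩ := hg Q' hQ'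
    rw [← heq] at hQ'm
    have fm := σ.line_fixed_of_two_fixed hQm hQ'm hQQ' hQfix hQ'fix
    exact hXnot (σ.point_fixed_of_two_fixed hXm hXl hml fm hl)
  have := Finset.card_le_card_of_injOn g hmaps hinj
  rwa [hLXcard] at this

end Collineation

end Summit.Ventures.DiscreteObjects.PP12
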